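import Summits.NavierStokesRegularity.TurbBounds.Certs.P2R0.EvalBlocks
import Summits.NavierStokesRegularity.TurbBounds.IntervalLemma
import Summits.NavierStokesRegularity.TurbBounds.IntervalLemmaR
import HarnessLib

/-!
# Evaluator for row P2R0 — the element rule `M_el(ε; u, v)` of SPEC-P2 §1, the seven block identities, and the
# kernel-checked FINITE CERTIFICATE of P2R0 on the wavenumber CONTINUUM `0 < K ≤ K_c = 7/2`
(cell `pub-turb` / `turb-bounds`, task T12 / LEAN-MAP §1–§2 step 5 'evaluator lemma'; producer pub-turb-sos = planner-pub-turb-sos-g6-0;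
source container `HOME/pub-turb-sos/certs/P2-R0-soundness-linear-k4/cert.json`, rbcert-par/0, sha256 `97b1a358aef338de…`).

HONEST FRAMING: rigorous bounds for the stated PDE and boundary conditions; no claim about physical turbulence beyond the bound.
This file contains NO fluid mechanics and claims nothing about `Nu` by itself. WHAT IT KERNEL-CHECKS (nothing trusted, no
`native_decide`): with the member `(s, κ, η′) = (3/2, 4, 1)` of PARAM.md's family (`ĝ₀ = -3`, `T = Σ|ĝ_p| = 3`, `P = 0`) and the
Legendre truncation `N = 4` (`LW = 7` coefficients of `V_xx`, `LT = 6` of `Θ_x`, stacked `ψ = (c; d)`, dim 13):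
1. `Mel ε u v` — the element matrix rule of SPEC-P2 §1.6, `M_el = (s−1)·PW(u,v) + s·PT(v) + ĝ₀·CE₀ + T·CT(ε)`, written out as an
   AFFINE function of the wavenumber data `(u, v) = (KINV2, K2)` and of the Young weight `ε`: `PW(u,v) = PW0 + u·PWu + v·PWv`,
   `PT(v) = PT0 + v·PTv`, `CT(ε) = −ε·TW − ε⁻¹·TT`, from eight rational 13×13 PIECES (§2). The pieces are DATA transcribed from
   rbsdp SPEC 3.3–3.6 (integration ladders `D1, D0, DT`, Legendre norms `2/(2n+1)`, triple products `Λ(n,m′,0)`, tail weights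
   `ω_J`, `GW0+HW`, `GT0+HT`) by the producer script `t12_evaluator.py` (generator A = rbsdp 0.2.x / p2el 0.1.x, unmodified);
   that these literal matrices ARE those Legendre–Galerkin objects is NOT proved here (it is what generator B re-derives
   independently: gen_b A/B PIECEWISE EQUAL 7/7, tribunal/t2-verify.md) — see 'NOT CHECKED' below.
2. `eval_k` (k = 1…7): the certified block of `Certs.P2R0.B00k` IS the rule evaluated at the block's data,
   `B00k.A = den_k • Mel ε_k u_k v_k` — 7 × 169 rational identities by `decide +kernel` (the 'evaluator lemma' of LEAN-MAP §1).
3. `Mel_pencil`: `Mel ε u v = M0 ε + u • Acoef + v • Bcoef` (module algebra, `ring`), and Gram certificates (`PSD.IsGramCert`,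
   `decide +kernel`, tree soundness theorem `IsGramCert.posSemidef`) for BOTH pencil coefficients: `Acoef = (s−1)·16·diag(2/(2n+1)) ⊕ 0`
   and `Bcoef = (s−1)·D0ᵀdiag(2/(2n+1))D0 ⊕ s·DTᵀdiag(2/(2n+1))DT` are positive semidefinite (the hypothesis of the interval lemma R-I).
4. `interval_1 … interval_4`: by the tree's interval lemma (`posSemidef_pencil_on_interval_tangent`, IntervalLemma.lean, p243191)
   and its 'bottom' companion (`posSemidef_pencil_on_bottom`, IntervalLemmaR.lean, staged with this file), the REAL matrix `MelR ε (1/K) K` is positive semidefinite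
   for EVERY real `K` of each cover interval (0, 1/2] · [1/2, 1] · [1, 2] · [2, 7/2].
5. `certificate`: for every real `K` with `0 < K ≤ 7/2` there is an `ε` among the listed block weights with `MelR ε (1/K) K ⪰ 0` AND the two
   scalar tail slacks `16·(1/K)·(s−1) − T·ε·λ_W ≥ 0`, `4s − T·λ_T/ε ≥ 0` (λ_W = 16/36465, λ_T = 4/165; `lamW_rule`/`lamT_rule` re-derive them from
   rbsdp 3.4/3.6's closed form `λ(J, J+1) = 4/((2J+1)(2J+5))` at `LW = 7`, `LT = 6`); and `cutoff`: `T² ≤ (s−1)·s·K_c²` at `K_c = 7/2`.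

HOW THIS IS USED (refereed prose, NOT formalised — HOME/pub-turb-sos/P2-PROOF.md §2, tribunal/t-lemmas.md passes 1–3): by the tail lemma
R-T / R-P2d (rbsdp SPEC 3.4–3.7 on the one-sided element), `Mel ε (1/K) K ⪰ 0` with both slacks `≥ 0` implies that the rescaled layer form
`2Q̃_K{V,Θ} = ∫_{−1}^{1} (s−1)[16V_xx²/K + 8V_x² + KV²] + s[4Θ_x² + KΘ²] + 2g·VΘ dx` (g ≡ ĝ₀ = −sκ/2·η′) is `≥ 0` on the class
`V(−1) = V_x(−1) = 0, Θ(−1) = 0`; by the cutoff lemma R-P2c(ii) (scalar core kernel-checked in `TurbBounds/Cutoff.lean`, staged) the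
same holds for every `K ≥ K_c`; by R-P2a/b (wall restriction + layer rescaling `K = (kδ)²`, `δ = κRa^{−1/2}`) this is the spectral
constraint of the Doering–Constantin background method in Ding–Kerswell's affine form [cite: DingKerswell2019, (13)–(16)] for all
wavenumbers `k` and all `Ra ≥ 4κ² = 64`, whence `Nu ≤ (sI₂/(2κ))·Ra^{1/2} − (s−1) = (3/16)·Ra^{1/2} − 1/2` (row P2-R0 of HOME/CERTIFIED.md;
no-slip isothermal plates, every Pr, every horizontal period, d = 2, 3).

NOT CHECKED HERE (LEAN-MAP items): (a) that the eight piece matrices are rbsdp's Legendre–Galerkin objects for (N, P) = (4, 0) — DATA,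
re-derivable from SPEC 3.3–3.6 by anyone and re-derived by generator B; (b) that `ĝ₀ = -3` is the Legendre datum of `g = −(sκ/2)η′` —
arithmetic done in `Certs.P2R0.Scalars` (staged) and by gen_b; (c) the analysis lemmas R-T, R-P2a–c and the cited reduction (prose).

FILE LAYOUT of the row-P2R0 evaluator (one namespace `Summit.NavierStokesRegularity.TurbBounds.Certs.P2R0.Evaluator` reopened across four files ≤ 400 lines, lead decision 55 (c)): `EvalData.lean` (§1–2: constants and the eight piece matrices — DATA) → `EvalRule.lean` (§3–4: the rule `Mel`, its pencil forms, Gram certificates of the pencil coefficients) → `EvalBlocks.lean` (§5: `eval_k`, each landed block `B0kk.A` IS the rule at its data) → `Evaluator.lean` (§6–8: the real pencil, the interval theorems, `cutoff`, **`certificate`** — the full statement of what is and is NOT kernel-checked is in THAT file's header); generic interval lemmas in `TurbBounds/IntervalLemma.lean` + `IntervalLemmaR.lean`.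
-/

set_option linter.style.longLine false
set_option linter.style.setOption false
set_option linter.unusedSimpArgs false
set_option maxRecDepth 100000

namespace Summit.NavierStokesRegularity.TurbBounds.Certs.P2R0.Evaluator

open Literature.Computation.Certificates Matrix

/-! ## 6. The real pencil and the transfer of block PSD facts to it -/

/-- The element rule over `ℝ` with REAL wavenumber data `(u, v)` (needed at `(1/K, K)` for irrational `K`). -/
noncomputable def MelR (ε : ℚ) (u v : ℝ) : Matrix (Fin 13) (Fin 13) ℝ :=
  (M0 ε).map (Rat.cast : ℚ → ℝ) + u • Acoef.map (Rat.cast : ℚ → ℝ) + v • Bcoef.map (Rat.cast : ℚ → ℝ)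

/-- At rational data the real pencil is the cast of the rational rule. -/
theorem MelR_eq_map (ε u v : ℚ) : MelR ε (u : ℝ) (v : ℝ) = (Mel ε u v).map (Rat.cast : ℚ → ℝ) := by
  ext i j
  simp only [MelR, Mel_pencil, Matrix.add_apply, Matrix.smul_apply, Matrix.map_apply, smul_eq_mul, Rat.cast_add,
    Rat.cast_mul]

/-- Transfer: if a kernel-certified PSD block `A` equals `den • Mel ε u v` with `den > 0`, the real pencil is PSD at `(u, v)`. -/
theorem MelR_posSemidef_of_eval {A : QMat} {den ε u v : ℚ} (hden : 0 < den) (h : A = den • Mel ε u v)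
    (hA : (A.map (Rat.cast : ℚ → ℝ)).PosSemidef) {u' v' : ℝ} (hu : u' = (u : ℝ)) (hv : v' = (v : ℝ)) :
    (MelR ε u' v').PosSemidef := by
  subst hu; subst hv
  have hcast : A.map (Rat.cast : ℚ → ℝ) = (den : ℝ) • MelR ε (u : ℝ) (v : ℝ) := by
    rw [MelR_eq_map, h]
    ext i j
    simp only [Matrix.map_apply, Matrix.smul_apply, smul_eq_mul, Rat.cast_mul]
  have hden' : (0 : ℝ) < (den : ℝ) := by exact_mod_cast hden
  have hinv : MelR ε (u : ℝ) (v : ℝ) = (den : ℝ)⁻¹ • A.map (Rat.cast : ℚ → ℝ) := by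
    rw [hcast, smul_smul, inv_mul_cancel₀ hden'.ne', one_smul]
  rw [hinv]
  exact hA.smul (inv_nonneg.mpr hden'.le)

/-! ## 7. Positive semidefiniteness on every K-interval of the cover (interval lemma R-I, tangent form from `IntervalLemma.lean`, 'bottom' companion from `IntervalLemmaR.lean`) -/


/-- **Interval 1** `(0, 1/2]` (bottom block 1): `MelR εI1 (1/K) K ⪰ 0` for every real `0 < K ≤ 1/2`. -/
theorem interval_1 : ∀ K : ℝ, 0 < K → K ≤ ((1 : ℝ) / 2) → (MelR εI1 (1 / K) K).PosSemidef := by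
  have h := MelR_posSemidef_of_eval den1_pos eval1 B001.posSemidef (u' := 1 / ((1 : ℝ) / 2)) (v' := 0)
    (by norm_num [u1]) (by norm_num [v1])
  intro K hK hK'
  exact posSemidef_pencil_on_bottom ((M0 εI1).map (Rat.cast : ℚ → ℝ)) (Acoef.map (Rat.cast : ℚ → ℝ))
    (Bcoef.map (Rat.cast : ℚ → ℝ)) Acoef_posSemidef Bcoef_posSemidef h K hK hK'

/-- **Interval 2** `[1/2, 1]` (tangent pair: blocks 2, 3; `Kt = 1`): `MelR εI2 (1/K) K ⪰ 0` for every real `K` in it. -/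
theorem interval_2 : ∀ K : ℝ, ((1 : ℝ) / 2) ≤ K → K ≤ (1 : ℝ) → (MelR εI2 (1 / K) K).PosSemidef := by
  have h1 := MelR_posSemidef_of_eval den2_pos eval2 B002.posSemidef
    (u' := (2 * (1 : ℝ) - ((1 : ℝ) / 2)) / (1 : ℝ) ^ 2) (v' := ((1 : ℝ) / 2)) (by norm_num [u2]) (by norm_num [v2])
  have h2 := MelR_posSemidef_of_eval den3_pos eval3 B003.posSemidef
    (u' := 1 / (1 : ℝ)) (v' := (1 : ℝ)) (by norm_num [u3]) (by norm_num [v3])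
  intro K hK hK'
  exact posSemidef_pencil_on_interval_tangent ((M0 εI2).map (Rat.cast : ℚ → ℝ)) (Acoef.map (Rat.cast : ℚ → ℝ))
    (Bcoef.map (Rat.cast : ℚ → ℝ)) Acoef_posSemidef (by norm_num : (0 : ℝ) < ((1 : ℝ) / 2)) (by norm_num : (((1 : ℝ) / 2) : ℝ) ≤ (1 : ℝ))
    h1 h2 K hK hK'

/-- **Interval 3** `[1, 2]` (tangent pair: blocks 4, 5; `Kt = 2`): `MelR εI3 (1/K) K ⪰ 0` for every real `K` in it. -/
theorem interval_3 : ∀ K : ℝ, (1 : ℝ) ≤ K → K ≤ (2 : ℝ) → (MelR εI3 (1 / K) K).PosSemidef := by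
  have h1 := MelR_posSemidef_of_eval den4_pos eval4 B004.posSemidef
    (u' := (2 * (2 : ℝ) - (1 : ℝ)) / (2 : ℝ) ^ 2) (v' := (1 : ℝ)) (by norm_num [u4]) (by norm_num [v4])
  have h2 := MelR_posSemidef_of_eval den5_pos eval5 B005.posSemidef
    (u' := 1 / (2 : ℝ)) (v' := (2 : ℝ)) (by norm_num [u5]) (by norm_num [v5])
  intro K hK hK'
  exact posSemidef_pencil_on_interval_tangent ((M0 εI3).map (Rat.cast : ℚ → ℝ)) (Acoef.map (Rat.cast : ℚ → ℝ))
    (Bcoef.map (Rat.cast : ℚ → ℝ)) Acoef_posSemidef (by norm_num : (0 : ℝ) < (1 : ℝ)) (by norm_num : ((1 : ℝ) : ℝ) ≤ (2 : ℝ))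
    h1 h2 K hK hK'

/-- **Interval 4** `[2, 7/2]` (tangent pair: blocks 6, 7; `Kt = 7/2`): `MelR εI4 (1/K) K ⪰ 0` for every real `K` in it. -/
theorem interval_4 : ∀ K : ℝ, (2 : ℝ) ≤ K → K ≤ ((7 : ℝ) / 2) → (MelR εI4 (1 / K) K).PosSemidef := by
  have h1 := MelR_posSemidef_of_eval den6_pos eval6 B006.posSemidef
    (u' := (2 * ((7 : ℝ) / 2) - (2 : ℝ)) / ((7 : ℝ) / 2) ^ 2) (v' := (2 : ℝ)) (by norm_num [u6]) (by norm_num [v6])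
  have h2 := MelR_posSemidef_of_eval den7_pos eval7 B007.posSemidef
    (u' := 1 / ((7 : ℝ) / 2)) (v' := ((7 : ℝ) / 2)) (by norm_num [u7]) (by norm_num [v7])
  intro K hK hK'
  exact posSemidef_pencil_on_interval_tangent ((M0 εI4).map (Rat.cast : ℚ → ℝ)) (Acoef.map (Rat.cast : ℚ → ℝ))
    (Bcoef.map (Rat.cast : ℚ → ℝ)) Acoef_posSemidef (by norm_num : (0 : ℝ) < (2 : ℝ)) (by norm_num : ((2 : ℝ) : ℝ) ≤ ((7 : ℝ) / 2))
    h1 h2 K hK hK'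

/-! ## 8. Tail slacks on the continuum, the cutoff scalar, and the assembled certificate -/

/-- The `W`-slack `16·u·(s−1) − T·ε·λ_W` is increasing in `u = 1/K`, so on `K ≤ Khi` it is at least its value at `u = 1/Khi`. -/
theorem slackW_of_le {K Khi : ℝ} {ε : ℚ} (hK : 0 < K) (hle : K ≤ Khi)
    (hbase : 0 ≤ 16 * (1 / Khi) * ((s : ℝ) - 1) - (T : ℝ) * (ε : ℝ) * (lamW : ℝ)) :
    0 ≤ 16 * (1 / K) * ((s : ℝ) - 1) - (T : ℝ) * (ε : ℝ) * (lamW : ℝ) := by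
  have h1 : 1 / Khi ≤ 1 / K := one_div_le_one_div_of_le hK hle
  have hs : (0 : ℝ) ≤ (s : ℝ) - 1 := by norm_num [s]
  nlinarith [mul_le_mul_of_nonneg_right h1 hs]

/-- **Cutoff scalar** (SPEC-P2 §1.7 / Cutoff.lean `p2_cutoff_abs` hypothesis): `T² ≤ (s−1)·s·K_c²`, i.e. `9 ≤ 147/16`. -/
theorem cutoff : T ^ 2 ≤ (s - 1) * s * K_c ^ 2 := by norm_num [T, s, K_c]

/-- **THE FINITE CERTIFICATE OF ROW P2R0 ON THE CONTINUUM.** For every real wavenumber datum `0 < K ≤ K_c = 7/2` one of the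
row's element LMIs holds AT `(u, v) = (1/K, K)` together with both scalar tail slacks: there is a Young weight `ε`
(one of `εI1 … εI4`) with `MelR ε (1/K) K ⪰ 0`, `16(1/K)(s−1) − Tελ_W ≥ 0` and `4s − Tλ_T/ε ≥ 0`. Assembled from
`interval_1 … interval_4`, `slackW_of_le` and the blocks' rational slack values; see the module docstring for what
this implies (via refereed prose) and what it does not check. -/
theorem certificate (K : ℝ) (hK : 0 < K) (hKc : K ≤ (K_c : ℝ)) :
    ∃ ε : ℚ, 0 < ε ∧ (MelR ε (1 / K) K).PosSemidef ∧
      0 ≤ 16 * (1 / K) * ((s : ℝ) - 1) - (T : ℝ) * (ε : ℝ) * (lamW : ℝ) ∧ 0 ≤ 4 * s - T * lamT / ε := by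
  have hKc' : K ≤ ((7 : ℝ) / 2) := by
    have e : ((K_c : ℚ) : ℝ) = ((7 : ℝ) / 2) := by norm_num [K_c]
    rw [e] at hKc
    exact hKc
  by_cases hc1 : K ≤ ((1 : ℝ) / 2)
  · exact ⟨εI1, by norm_num [εI1], interval_1 K hK hc1,
      slackW_of_le hK hc1 (by norm_num [s, T, εI1, lamW]), by norm_num [s, T, εI1, lamT]⟩
  have hc1' : ((1 : ℝ) / 2) < K := not_le.mp hc1
  by_cases hc2 : K ≤ (1 : ℝ)
  · exact ⟨εI2, by norm_num [εI2], interval_2 K hc1'.le hc2,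
      slackW_of_le hK hc2 (by norm_num [s, T, εI2, lamW]), by norm_num [s, T, εI2, lamT]⟩
  have hc2' : (1 : ℝ) < K := not_le.mp hc2
  by_cases hc3 : K ≤ (2 : ℝ)
  · exact ⟨εI3, by norm_num [εI3], interval_3 K hc2'.le hc3,
      slackW_of_le hK hc3 (by norm_num [s, T, εI3, lamW]), by norm_num [s, T, εI3, lamT]⟩
  have hc3' : (2 : ℝ) < K := not_le.mp hc3
  exact ⟨εI4, by norm_num [εI4], interval_4 K hc3'.le hKc',
      slackW_of_le hK hKc' (by norm_num [s, T, εI4, lamW]), by norm_num [s, T, εI4, lamT]⟩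

end Summit.NavierStokesRegularity.TurbBounds.Certs.P2R0.Evaluator
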